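import Summits.MatrixMultiplication.MatrixMultiplication.Theorems.FarEdgeDescentChord
import Summits.MatrixMultiplication.MatrixMultiplication.Theorems.FarEdgeDescentTailShadow
import HarnessLib

/-!
# Route `FarEdgeDescent` — THE GAP-FRACTION SCALE between the proved Kronecker chord and the crux:
# no fixed fraction `θ < 1` of the AM–GM gain is a usable generic leaf (power-contact worlds of order `2^{j+1}`)
(lens-2 «special vs generic», gen 44, Kernel XIX; support module for the crux `AnchoredLogConvexity`
stmt-MatrixMultiplication-28900; companions `FarEdgeDescentChord` (gen 8), `FarEdgeDescentHankelOrderThree` (gen 43);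
def-free; the cut of record `closes (h₁ : FiniteSaturation) (h₂ : AnchoredLogConvexity)` is UNCHANGED)

`e(x) := ω(1,x,1) − (x+1)`, `AM(m) := (e(1) + e(2m−1))/2`, `GM(m) := √(e(1)·e(2m−1))`.  The tree PROVES the chord
`e(m) ≤ AM(m)` (`FarEdgeDescentChord.alc_chord`: Kronecker `⟨n,n,n⟩ ⊗ ⟨n,n^{2m−1},n⟩ = ⟨n²,(n²)^m,n²⟩` and
Lotti–Romani convexity) and the crux IS `e(m) ≤ GM(m)` (`alc_iff_geomMean`, gain form `alc_iff_chordGain`).  Memo U11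
asks for the tensor MECHANISM saving this gain; this module quantifies HOW MUCH of it must be saved.  The excess obeys
the **gap law of fraction `θ`** (inline, no definition) if `∀ m > 1, e(m) ≤ (1 − θ)·AM(m) + θ·GM(m)`, i.e.
`θ·(AM − GM) ≤ AM − e(m)` (`gapLaw_iff_savedFraction`).

* §1 TRUE EXPONENTS (by name over tree theorems): `θ = 0` is the chord, a THEOREM (`gapLaw_zero`); `θ = 1` IS the
  crux (`alc_iff_gapLaw_one`); the scale is monotone (`gapLaw_anti`), so the crux gives every `θ ≤ 1`
  (`gapLaw_of_alc`) and the summit every `θ` (`gapLaw_of_mm`); AT A FAR ZERO a `θ`-law buys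
  `e(2m−1) = 0 ⟹ e(m) ≤ (1−θ)·e(1)/2` (`gapLaw_at_farZero`) — the halving step of `closes`
  (`FarEdgeDescentChord.halving_step`) is `θ = 1` there (zero absorption); for `θ < 1` the law is degree-one
  homogeneous in `e` and forces no zero, so it constrains the SHAPE of `e` but never `e(1) = ω − 2`.
* §2 THE DOUBLING INEQUALITY `midpointPow_le` (pure algebra): for `n = 2^j` and every real `a`,
  `((1+a)/2)^{2n} ≤ (1 − 1/(2n))·aⁿ + (1 + a^{2n})/(4n)` — equality at `n = 1`; the step `n → 2n` is the identity
  `T − B² = (1−aⁿ)⁴(2n−1)/(16n²)`.  (Power means: `M₂^{2n} ≤ (1/n)M_{2n}^{2n} + (1−1/n)M₀^{2n}` for the pair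
  `(1,√a)`, alias `cosh(t)^p ≤ 1 + (cosh(pt) − 1)/p`, `p = 2n`; true for every integer `p ≥ 1` by
  `𝔼 S_p^{2k} ≤ p^{2k−1}` for a sum `S_p` of `p` signs — memo; typed for `p = 2^{j+1}`, all that §4 needs.)
* §3 THE POWER-CONTACT WORLDS `gapWorld j c` (`0 < c ≤ 1/2`): the far excess `c·((K−x)₊/(K−1))^{2n}`, `n = 2^j`,
  `K = 6n+1`, is convex, antitone, `≥ 0`, cube-line coupled (Bernoulli), hence by the landed far-tail freedom theorem
  `FarEdgeDescentTailShadow.farTail_realisable` the far excess of a 3D-LAWFUL `W` with: `FiniteSaturation`-shape at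
  `K`; the gap law of fraction `θ_j = 1 − 1/2^{j+1}` (§2 at `a = (K−2m+1)₊/(K−1)`, as `(K−m)/(K−1) = (1+a)/2`);
  `AnchoredLogConvexity`-shape FALSE (zero propagation `K ↦ (1+K)/2`); `W(1,1,1) = 2 + c`.
* §4 ★ `gapLaw_insufficient`: for EVERY `θ < 1` such a world exists — modulo the shape laws no gap law of fraction
  `θ < 1` replaces the crux next to the special leaf, while `θ = 1` is the crux and closes the summit with it
  (`closes`).  DICTIONARY: saving the fraction `1 − 1/p` of the gain is compatible with contact of order `p`
  at the saturation threshold (sharp: memo); the crux is the `p = ∞` end — the quantitative form of the contact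
  readings `FarEdgeDescentContactScale` (SuperFactorialContact ⟹ SuperExpContact).

INSTRUMENT SCALAR (U11).  `θ̂(m) := (AM − ê(m))/(AM − GM)` of a method profile `ê`: printed VXXZ-2024 proxy (tree
`vxxz2024_omegaRect_table`) `θ̂(1.1) = 2.66`, `θ̂(1.5) = 2.69`, `θ̂(2) = 2.60`; `1/log` world `2.78`, harmonic
`1.87`, exponential `1.00` (boundary), power contact of order `p`: `1 − 1/p`.  The mechanism sought must give
`θ̂ ≥ 1` for the TRUE excess and exactly all the slack at a far zero.  Nothing here proves `ω = 2`; tag of 28900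
IDEA-NEEDED unchanged.  (Power means: compare the log-convexity of `r ↦ M_r^r`, Bullen, *A Dictionary of
Inequalities*, «Power Mean Inequalities» (d), p. 156.)  [cite: LottiRomani1983, §2 (p. 174)]
[cite: HuangPan1998, §2 eq. (2.5)–(2.8)] [cite: VassilevskaWilliamsXuXuZhou2024, Table 1]
-/

set_option linter.dupNamespace false

noncomputable section

namespace Summit.MatrixMultiplication.MatrixMultiplication.Theorems.FarEdgeDescentGapFraction

open Literature.Computability.AlgebraicComplexity Set
open Summit.MatrixMultiplication.MatrixMultiplication.Theses.FarEdgeDescent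
open Summit.MatrixMultiplication.MatrixMultiplication.Theorems.FarEdgeDescentChord
open Summit.MatrixMultiplication.MatrixMultiplication.Theorems.FarEdgeDescentTailShadow

/-! ## §0 An elementary fact -/

/-- `√(x·(x·z²)) = x·z` for `x, z ≥ 0` (the geometric mean of `c` and `c·a^{2n}` is `c·aⁿ`). -/
theorem sqrt_mul_mul_sq {x z : ℝ} (hx : 0 ≤ x) (hz : 0 ≤ z) : Real.sqrt (x * (x * z ^ 2)) = x * z := by
  rw [show x * (x * z ^ 2) = (x * z) ^ 2 by ring]
  exact Real.sqrt_sq (mul_nonneg hx hz)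

/-! ## §1 The gap-fraction scale for the true exponents -/

/-- **`θ = 0` is the chord — a THEOREM** (`FarEdgeDescentChord.alc_chord`, Lotti–Romani). -/
theorem gapLaw_zero : ∀ m : ℝ, 1 < m →
    omegaRect ℂ 1 m 1 - (m + 1) ≤
      (1 - 0) * (((omegaRect ℂ 1 1 1 - 2) + (omegaRect ℂ 1 (2 * m - 1) 1 - 2 * m)) / 2) +
        0 * Real.sqrt ((omegaRect ℂ 1 1 1 - 2) * (omegaRect ℂ 1 (2 * m - 1) 1 - 2 * m)) := by
  intro m hm
  have h := alc_chord hm.le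
  linarith

/-- **`θ = 1` IS the crux** (`FarEdgeDescentChord.alc_iff_geomMean`). -/
theorem alc_iff_gapLaw_one : AnchoredLogConvexity ↔ ∀ m : ℝ, 1 < m →
    omegaRect ℂ 1 m 1 - (m + 1) ≤
      (1 - 1) * (((omegaRect ℂ 1 1 1 - 2) + (omegaRect ℂ 1 (2 * m - 1) 1 - 2 * m)) / 2) +
        1 * Real.sqrt ((omegaRect ℂ 1 1 1 - 2) * (omegaRect ℂ 1 (2 * m - 1) 1 - 2 * m)) := by
  rw [alc_iff_geomMean]
  refine forall_congr' fun m => forall_congr' fun hm => ?_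
  rw [sub_self, zero_mul, zero_add, one_mul]

/-- **The scale is monotone**: the gap law of fraction `θ'` implies the gap law of every fraction `θ ≤ θ'`
(AM ≥ GM, both excesses being `≥ 0`). -/
theorem gapLaw_anti {θ θ' : ℝ} (hθ : θ ≤ θ')
    (h : ∀ m : ℝ, 1 < m → omegaRect ℂ 1 m 1 - (m + 1) ≤
      (1 - θ') * (((omegaRect ℂ 1 1 1 - 2) + (omegaRect ℂ 1 (2 * m - 1) 1 - 2 * m)) / 2) +
        θ' * Real.sqrt ((omegaRect ℂ 1 1 1 - 2) * (omegaRect ℂ 1 (2 * m - 1) 1 - 2 * m))) :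
    ∀ m : ℝ, 1 < m → omegaRect ℂ 1 m 1 - (m + 1) ≤
      (1 - θ) * (((omegaRect ℂ 1 1 1 - 2) + (omegaRect ℂ 1 (2 * m - 1) 1 - 2 * m)) / 2) +
        θ * Real.sqrt ((omegaRect ℂ 1 1 1 - 2) * (omegaRect ℂ 1 (2 * m - 1) 1 - 2 * m)) := by
  intro m hm
  have hx := excess_one_nonneg
  have hy := excess_nonneg_two m
  have hag : Real.sqrt ((omegaRect ℂ 1 1 1 - 2) * (omegaRect ℂ 1 (2 * m - 1) 1 - 2 * m)) ≤
      ((omegaRect ℂ 1 1 1 - 2) + (omegaRect ℂ 1 (2 * m - 1) 1 - 2 * m)) / 2 := by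
    rw [Real.sqrt_mul' _ hy]
    nlinarith [Real.sq_sqrt hx, Real.sq_sqrt hy, Real.sqrt_nonneg (omegaRect ℂ 1 1 1 - 2),
      sq_nonneg (Real.sqrt (omegaRect ℂ 1 1 1 - 2) - Real.sqrt (omegaRect ℂ 1 (2 * m - 1) 1 - 2 * m))]
  have h' := h m hm
  nlinarith [mul_le_mul_of_nonneg_left hag (sub_nonneg.2 hθ)]

/-- The crux gives the gap law of EVERY fraction `θ ≤ 1`. -/
theorem gapLaw_of_alc (hA : AnchoredLogConvexity) {θ : ℝ} (hθ : θ ≤ 1) :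
    ∀ m : ℝ, 1 < m → omegaRect ℂ 1 m 1 - (m + 1) ≤
      (1 - θ) * (((omegaRect ℂ 1 1 1 - 2) + (omegaRect ℂ 1 (2 * m - 1) 1 - 2 * m)) / 2) +
        θ * Real.sqrt ((omegaRect ℂ 1 1 1 - 2) * (omegaRect ℂ 1 (2 * m - 1) 1 - 2 * m)) :=
  gapLaw_anti hθ (alc_iff_gapLaw_one.1 hA)

/-- NECESSITY: under the summit the excess vanishes on `[1,∞)`, so the gap law holds for EVERY real `θ`. -/
theorem gapLaw_of_mm (hS : _root_.MatrixMultiplication) (θ : ℝ) :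
    ∀ m : ℝ, 1 < m → omegaRect ℂ 1 m 1 - (m + 1) ≤
      (1 - θ) * (((omegaRect ℂ 1 1 1 - 2) + (omegaRect ℂ 1 (2 * m - 1) 1 - 2 * m)) / 2) +
        θ * Real.sqrt ((omegaRect ℂ 1 1 1 - 2) * (omegaRect ℂ 1 (2 * m - 1) 1 - 2 * m)) := by
  intro m hm
  have hω : omega ℂ = 2 := _root_.MatrixMultiplication_iff.1 hS
  have e1 : omegaRect ℂ 1 1 1 - 2 = 0 := by rw [omegaRect_one_one_one, hω]; ring
  have em : omegaRect ℂ 1 m 1 - (m + 1) = 0 := by rw [saturated_of_omega_eq_two hω hm.le]; ring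
  have e2 : omegaRect ℂ 1 (2 * m - 1) 1 - 2 * m = 0 := by
    rw [saturated_of_omega_eq_two hω (by linarith : (1 : ℝ) ≤ 2 * m - 1)]; ring
  simp [e1, em, e2]

/-- The SAVED-FRACTION reading: the gap law of fraction `θ` says `θ·(AM − GM) ≤ AM − e(m)`. -/
theorem gapLaw_iff_savedFraction (θ : ℝ) :
    (∀ m : ℝ, 1 < m → omegaRect ℂ 1 m 1 - (m + 1) ≤
      (1 - θ) * (((omegaRect ℂ 1 1 1 - 2) + (omegaRect ℂ 1 (2 * m - 1) 1 - 2 * m)) / 2) +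
        θ * Real.sqrt ((omegaRect ℂ 1 1 1 - 2) * (omegaRect ℂ 1 (2 * m - 1) 1 - 2 * m))) ↔
    ∀ m : ℝ, 1 < m →
      θ * ((((omegaRect ℂ 1 1 1 - 2) + (omegaRect ℂ 1 (2 * m - 1) 1 - 2 * m)) / 2) -
          Real.sqrt ((omegaRect ℂ 1 1 1 - 2) * (omegaRect ℂ 1 (2 * m - 1) 1 - 2 * m))) ≤
        (((omegaRect ℂ 1 1 1 - 2) + (omegaRect ℂ 1 (2 * m - 1) 1 - 2 * m)) / 2) -
          (omegaRect ℂ 1 m 1 - (m + 1)) := by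
  refine forall_congr' fun m => forall_congr' fun hm => ?_
  constructor <;> intro h <;> linarith

/-- **What a `θ`-mechanism buys at a far zero**: `e(2m−1) = 0 ⟹ e(m) ≤ (1−θ)·e(1)/2`.  For `θ = 1` this is the
halving step `closes` uses (`FarEdgeDescentChord.halving_step`); for `θ < 1` no zero is propagated. -/
theorem gapLaw_at_farZero {θ : ℝ}
    (h : ∀ m : ℝ, 1 < m → omegaRect ℂ 1 m 1 - (m + 1) ≤
      (1 - θ) * (((omegaRect ℂ 1 1 1 - 2) + (omegaRect ℂ 1 (2 * m - 1) 1 - 2 * m)) / 2) +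
        θ * Real.sqrt ((omegaRect ℂ 1 1 1 - 2) * (omegaRect ℂ 1 (2 * m - 1) 1 - 2 * m)))
    {m : ℝ} (hm : 1 < m) (hz : omegaRect ℂ 1 (2 * m - 1) 1 = 2 * m) :
    omegaRect ℂ 1 m 1 - (m + 1) ≤ (1 - θ) * ((omegaRect ℂ 1 1 1 - 2) / 2) := by
  have h' := h m hm
  rw [hz, sub_self, mul_zero, Real.sqrt_zero, mul_zero, add_zero, add_zero] at h'
  exact h'

/-! ## §2 The doubling inequality -/

/-- **`((1+a)/2)^{2n} ≤ (1 − 1/(2n))·aⁿ + (1 + a^{2n})/(4n)` for `n = 2^j` and every real `a`.**  Induction on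
`j`: equality at `n = 1`; if `X ≤ B := (1−1/(2n))G + (1+G²)/(4n)` with `G = aⁿ`, `X = ((1+a)/2)^{2n} ≥ 0`, then
`X² ≤ B²` and `T − B² = (1−G)⁴(2n−1)/(16n²) ≥ 0` for the next target `T = (1−1/(4n))G² + (1+G⁴)/(8n)`. -/
theorem midpointPow_le (j : ℕ) (a : ℝ) :
    ((1 + a) / 2) ^ (2 * 2 ^ j) ≤
      (1 - 1 / (2 * (2 : ℝ) ^ j)) * a ^ (2 ^ j) + (1 + a ^ (2 * 2 ^ j)) / (4 * (2 : ℝ) ^ j) := by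
  induction j with
  | zero => norm_num; nlinarith [sq_nonneg (1 - a)]
  | succ j ih =>
    have hN : (1 : ℝ) ≤ (2 : ℝ) ^ j := one_le_pow₀ (by norm_num)
    have hX0 : 0 ≤ ((1 + a) / 2) ^ (2 * 2 ^ j) := by rw [pow_mul]; positivity
    have eG2 : a ^ (2 * 2 ^ j) = (a ^ (2 ^ j)) ^ 2 := by rw [mul_comm, pow_mul]
    have e1 : (2 : ℝ) ^ (j + 1) = 2 * (2 : ℝ) ^ j := by rw [pow_succ]; ring
    have e2 : a ^ (2 ^ (j + 1)) = (a ^ (2 ^ j)) ^ 2 := by rw [pow_succ, pow_mul]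
    have e3 : a ^ (2 * 2 ^ (j + 1)) = (a ^ (2 ^ j)) ^ 4 := by
      rw [show 2 * 2 ^ (j + 1) = 2 ^ j * 4 by ring, pow_mul]
    have e4 : ((1 + a) / 2) ^ (2 * 2 ^ (j + 1)) = (((1 + a) / 2) ^ (2 * 2 ^ j)) ^ 2 := by
      rw [show 2 * 2 ^ (j + 1) = (2 * 2 ^ j) * 2 by ring, pow_mul]
    rw [e1, e2, e3, e4]; rw [eG2] at ih
    set N : ℝ := (2 : ℝ) ^ j with hN_def
    set G : ℝ := a ^ (2 ^ j) with hG_def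
    set X : ℝ := ((1 + a) / 2) ^ (2 * 2 ^ j) with hX_def
    have hN0 : 0 < N := by positivity
    have hB : X ≤ (1 - 1 / (2 * N)) * G + (1 + G ^ 2) / (4 * N) := ih
    have hsq : X ^ 2 ≤ ((1 - 1 / (2 * N)) * G + (1 + G ^ 2) / (4 * N)) ^ 2 := pow_le_pow_left₀ hX0 hB 2
    have key : ((1 - 1 / (2 * N)) * G + (1 + G ^ 2) / (4 * N)) ^ 2 +
        (1 - G) ^ 4 * (2 * N - 1) / (16 * N ^ 2) =
        (1 - 1 / (2 * (2 * N))) * G ^ 2 + (1 + G ^ 4) / (4 * (2 * N)) := by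
      field_simp; ring
    have h2N : 0 ≤ 2 * N - 1 := by linarith
    have hpos : 0 ≤ (1 - G) ^ 4 * (2 * N - 1) / (16 * N ^ 2) := by positivity
    linarith

/-! ## §3 The power-contact worlds of order `2^{j+1}` -/

/-- **The power-contact world of order `2n = 2^{j+1}`.**  For every `j` and every `0 < c ≤ 1/2` there is a
3D-LAWFUL functional `W` (symmetric, positively homogeneous, subadditive, monotone in the middle argument,
sandwiched) whose far excess is `c·((K−x)₊/(K−1))^{2n}` with `K = 6n+1`: the special-leaf shape holds at `K`,
the GAP LAW OF FRACTION `1 − 1/2^{j+1}` holds, the crux-shape `AnchoredLogConvexity` FAILS, and `W(1,1,1) = 2 + c`. -/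
theorem gapWorld (j : ℕ) {c : ℝ} (hc : 0 < c) (hc2 : c ≤ 1 / 2) :
    ∃ W : ℝ → ℝ → ℝ → ℝ,
      ((∀ x y z : ℝ, W x y z = W y x z ∧ W x y z = W x z y) ∧
        (∀ ν : ℝ, 0 < ν → ∀ x y z : ℝ, 0 < x → 0 < y → 0 < z →
          W (ν * x) (ν * y) (ν * z) = ν * W x y z) ∧
        (∀ x y z x' y' z' : ℝ, 0 < x → 0 < y → 0 < z → 0 < x' → 0 < y' → 0 < z' →
          W (x + x') (y + y') (z + z') ≤ W x y z + W x' y' z') ∧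
        (∀ x y y' z : ℝ, 0 < x → 0 < y → y ≤ y' → 0 < z → W x y z ≤ W x y' z) ∧
        (∀ x y z : ℝ, 0 < x → 0 < y → 0 < z →
          max (x + z) (max (x + y) (y + z)) ≤ W x y z ∧ W x y z ≤ x + y + z)) ∧
      (∃ K : ℕ, 2 ≤ K ∧ W 1 K 1 = K + 1) ∧
      (∀ m : ℝ, 1 < m → W 1 m 1 - (m + 1) ≤
        (1 - (1 - 1 / (2 * (2 : ℝ) ^ j))) * (((W 1 1 1 - 2) + (W 1 (2 * m - 1) 1 - 2 * m)) / 2) +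
          (1 - 1 / (2 * (2 : ℝ) ^ j)) * Real.sqrt ((W 1 1 1 - 2) * (W 1 (2 * m - 1) 1 - 2 * m))) ∧
      (¬ ∀ m : ℝ, 1 < m → (W 1 m 1 - (m + 1)) ^ 2 ≤ (W 1 1 1 - 2) * (W 1 (2 * m - 1) 1 - 2 * m)) ∧
      W 1 1 1 = 2 + c := by
  set N : ℝ := (2 : ℝ) ^ j with hN_def
  have hN1 : (1 : ℝ) ≤ N := one_le_pow₀ (by norm_num)
  have hN0 : 0 < N := by positivity
  set D : ℝ := 6 * N with hD_def
  have hD0 : 0 < D := by positivity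
  set Kn : ℕ := 6 * 2 ^ j + 1 with hKn_def
  have hKreal : ((Kn : ℕ) : ℝ) = D + 1 := by
    rw [hKn_def, hD_def, hN_def]; push_cast; ring
  have hKn2 : 2 ≤ Kn := by
    have : 1 ≤ 2 ^ j := Nat.one_le_two_pow
    omega
  set w : ℝ → ℝ := fun x => max (((Kn : ℝ) - x) / D) 0 with hw_def
  have hw0 : ∀ x, 0 ≤ w x := fun x => le_max_right _ _
  have hw1 : w 1 = 1 := by
    show max (((Kn : ℝ) - 1) / D) 0 = 1
    rw [hKreal, add_sub_cancel_right, div_self hD0.ne']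
    exact max_eq_left zero_le_one
  have hw_anti : ∀ x y : ℝ, x ≤ y → w y ≤ w x := fun x y hxy =>
    max_le_max (div_le_div_of_nonneg_right (by linarith) hD0.le) le_rfl
  set g : ℝ → ℝ := fun x => c * w x ^ (2 * 2 ^ j) with hg_def
  have hg : ∀ x, g x = c * w x ^ (2 * 2 ^ j) := fun x => rfl
  have hg1 : g 1 = c := by rw [hg, hw1, one_pow, mul_one]
  have hconv : ConvexOn ℝ (Ici 1) g := by
    have h1 : ConvexOn ℝ (Ici (1 : ℝ)) (fun y : ℝ => (Kn : ℝ) - y) :=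
      (convexOn_const (𝕜 := ℝ) ((Kn : ℕ) : ℝ) (convex_Ici (1 : ℝ))).sub (concaveOn_id (convex_Ici (1 : ℝ)))
    have h1' : ConvexOn ℝ (Ici (1 : ℝ)) (fun y : ℝ => ((Kn : ℝ) - y) / D) := by
      have h := h1.smul (inv_nonneg.2 hD0.le)
      refine h.congr fun y _ => ?_
      simp only [smul_eq_mul]
      rw [div_eq_inv_mul]
    have h2 : ConvexOn ℝ (Ici (1 : ℝ)) w := h1'.sup (convexOn_const (𝕜 := ℝ) (0 : ℝ) (convex_Ici (1 : ℝ)))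
    have h3 : ConvexOn ℝ (Ici (1 : ℝ)) (w ^ (2 * 2 ^ j)) := h2.pow (fun y _ => hw0 y) (2 * 2 ^ j)
    have h4 : ConvexOn ℝ (Ici (1 : ℝ)) (fun x : ℝ => c • (w ^ (2 * 2 ^ j)) x) := h3.smul hc.le
    refine h4.congr fun y _ => ?_
    simp only [smul_eq_mul, Pi.pow_apply, hg]
  have hanti : AntitoneOn g (Ici 1) := by
    intro x _ y _ hxy
    rw [hg, hg]
    exact mul_le_mul_of_nonneg_left (pow_le_pow_left₀ (hw0 y) (hw_anti x y hxy) _) hc.le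
  have hnn : ∀ x : ℝ, 1 ≤ x → 0 ≤ g x := fun x _ => by rw [hg]; positivity
  have hbern : ∀ x : ℝ, 1 ≤ x → 1 - w x ^ (2 * 2 ^ j) ≤ (x - 1) / 3 := by
    intro x hx
    rcases le_or_gt x (Kn : ℝ) with hxK | hxK
    · have hwx : w x = 1 + (1 - x) / D := by
        show max (((Kn : ℝ) - x) / D) 0 = 1 + (1 - x) / D
        rw [max_eq_left (div_nonneg (by linarith) hD0.le), hKreal]
        field_simp
        ring
      have ht : -2 ≤ (1 - x) / D := by
        rw [le_div_iff₀ hD0]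
        have : x - 1 ≤ D := by rw [hKreal] at hxK; linarith
        linarith
      have hb := one_add_mul_le_pow ht (2 * 2 ^ j)
      rw [← hwx] at hb
      have hcast : ((2 * 2 ^ j : ℕ) : ℝ) = 2 * N := by rw [hN_def]; push_cast; ring
      rw [hcast] at hb
      have : 2 * N * ((1 - x) / D) = -((x - 1) / 3) := by
        rw [hD_def]; field_simp; ring
      linarith
    · have hwx : w x = 0 := by
        show max (((Kn : ℝ) - x) / D) 0 = 0
        exact max_eq_right (div_nonpos_of_nonpos_of_nonneg (by linarith) hD0.le)
      rw [hwx, zero_pow (by positivity), sub_zero]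
      have : D + 1 < x := by rw [hKreal] at hxK; exact hxK
      have hD6 : 6 ≤ D := by rw [hD_def]; linarith
      linarith
  have hcube : ∀ x : ℝ, 1 ≤ x → g 1 - g x ≤ (1 - g 1) / 3 * (x - 1) := by
    intro x hx
    rw [hg1, hg]
    have hb := hbern x hx
    have h1 : c * (1 - w x ^ (2 * 2 ^ j)) ≤ c * ((x - 1) / 3) := mul_le_mul_of_nonneg_left hb hc.le
    have h2 : c * ((x - 1) / 3) ≤ (1 - c) / 3 * (x - 1) := by
      have : c ≤ 1 - c := by linarith
      nlinarith [sub_nonneg.2 hx]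
    nlinarith
  obtain ⟨W, hsym, hhom, hsub, hmono, hsand, hfar, hone⟩ := farTail_realisable hconv hanti hnn hcube
  have hexc : ∀ x : ℝ, 1 ≤ x → W 1 x 1 - (x + 1) = c * w x ^ (2 * 2 ^ j) := fun x hx => by
    rw [hfar x hx, hg]; ring
  have hW1 : W 1 1 1 - 2 = c := by rw [hone, hg1]; ring
  have hsatK : W 1 Kn 1 = Kn + 1 := by
    have h := hexc Kn (by exact_mod_cast (by omega : 1 ≤ Kn))
    have hwK : w Kn = 0 := by
      show max (((Kn : ℝ) - Kn) / D) 0 = 0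
      rw [sub_self, zero_div, max_self]
    rw [hwK, zero_pow (by positivity), mul_zero] at h
    linarith
  refine ⟨W, ⟨hsym, hhom, hsub, hmono, hsand⟩, ⟨Kn, hKn2, hsatK⟩, ?_, ?_, ?_⟩
  · intro m hm -- the gap law of fraction `1 − 1/(2n)`
    have hA0 : 0 ≤ w (2 * m - 1) := hw0 _
    set A : ℝ := w (2 * m - 1) with hA_def
    have em : W 1 m 1 - (m + 1) = c * w m ^ (2 * 2 ^ j) := hexc m hm.le
    have e2 : W 1 (2 * m - 1) 1 - 2 * m = c * A ^ (2 * 2 ^ j) := by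
      have h := hexc (2 * m - 1) (by linarith)
      rw [← h]; ring
    rw [em, hW1, e2]
    have eA2 : A ^ (2 * 2 ^ j) = (A ^ (2 ^ j)) ^ 2 := by rw [mul_comm, pow_mul]
    have hGM : Real.sqrt (c * (c * A ^ (2 * 2 ^ j))) = c * A ^ (2 ^ j) := by
      rw [eA2]; exact sqrt_mul_mul_sq hc.le (pow_nonneg hA0 _)
    rw [hGM]
    -- `w(m) ≤ (1 + A)/2`, since `(K − m)/D = (1 + (K−2m+1)/D)/2` and `A ≥ (K−2m+1)/D`, `A ≥ 0`
    have hwm : w m ≤ (1 + A) / 2 := by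
      have hA1 : ((Kn : ℝ) - (2 * m - 1)) / D ≤ A := le_max_left _ _
      have hcalc : ((Kn : ℝ) - m) / D = (1 + ((Kn : ℝ) - (2 * m - 1)) / D) / 2 := by
        rw [hKreal]; field_simp; ring
      refine max_le ?_ (by linarith)
      rw [hcalc]
      linarith
    have hpow : w m ^ (2 * 2 ^ j) ≤ ((1 + A) / 2) ^ (2 * 2 ^ j) := pow_le_pow_left₀ (hw0 m) hwm _
    have hmid := midpointPow_le j A
    have hc' : c * w m ^ (2 * 2 ^ j) ≤
        c * ((1 - 1 / (2 * N)) * A ^ (2 ^ j) + (1 + A ^ (2 * 2 ^ j)) / (4 * N)) :=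
      mul_le_mul_of_nonneg_left (hpow.trans hmid) hc.le
    have halg : c * ((1 - 1 / (2 * N)) * A ^ (2 ^ j) + (1 + A ^ (2 * 2 ^ j)) / (4 * N)) =
        (1 - (1 - 1 / (2 * N))) * ((c + c * A ^ (2 * 2 ^ j)) / 2) + (1 - 1 / (2 * N)) * (c * A ^ (2 ^ j)) := by
      field_simp
      ring
    linarith
  · intro hL -- the crux-shape fails: zero propagation from `K` back to `(1+K)/2`
    have key := hL ((1 + Kn) / 2) (by rw [hKreal]; linarith)
    have e2 : W 1 (2 * ((1 + Kn) / 2) - 1) 1 - 2 * ((1 + (Kn : ℝ)) / 2) = 0 := by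
      have h := hexc (2 * ((1 + Kn) / 2) - 1) (by rw [hKreal]; linarith)
      have hwK : w (2 * ((1 + (Kn : ℝ)) / 2) - 1) = 0 := by
        show max (((Kn : ℝ) - (2 * ((1 + (Kn : ℝ)) / 2) - 1)) / D) 0 = 0
        rw [show (Kn : ℝ) - (2 * ((1 + (Kn : ℝ)) / 2) - 1) = 0 by ring, zero_div, max_self]
      rw [hwK, zero_pow (by positivity), mul_zero] at h
      linarith
    have e3 : W 1 ((1 + Kn) / 2) 1 - ((1 + (Kn : ℝ)) / 2 + 1) = c * (1 / 2) ^ (2 * 2 ^ j) := by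
      have h := hexc ((1 + Kn) / 2) (by rw [hKreal]; linarith)
      have hwm : w ((1 + (Kn : ℝ)) / 2) = 1 / 2 := by
        show max (((Kn : ℝ) - (1 + (Kn : ℝ)) / 2) / D) 0 = 1 / 2
        rw [hKreal, show (D + 1 - (1 + (D + 1)) / 2) / D = 1 / 2 by field_simp; ring]
        exact max_eq_left (by norm_num)
      rw [hwm] at h
      exact h
    rw [hW1, e2, e3, mul_zero] at key
    have : 0 < c * (1 / 2 : ℝ) ^ (2 * 2 ^ j) := by positivity
    nlinarith
  · linarith

/-! ## §4 No gap law of fraction `θ < 1` is a usable generic leaf -/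

/-- ★ **`gapLaw_insufficient`.**  For every `θ < 1` there is a 3D-LAWFUL functional with the special-leaf shape
(`∃ K ≥ 2, W(1,K,1) = K+1`), the gap law of fraction `θ`, WITHOUT the crux-shape `AnchoredLogConvexity`, and with
`W(1,1,1) > 2` — whereas for `θ = 1` the law is the crux and `FiniteSaturation ∧ AnchoredLogConvexity ⟹ ω = 2`
(`closes`).  So a mechanism that saves any FIXED fraction `θ < 1` of the Kronecker AM–GM gain cannot serve as the
generic leaf: at a far zero it must save all of it. -/
theorem gapLaw_insufficient {θ : ℝ} (hθ : θ < 1) :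
    ∃ W : ℝ → ℝ → ℝ → ℝ,
      ((∀ x y z : ℝ, W x y z = W y x z ∧ W x y z = W x z y) ∧
        (∀ ν : ℝ, 0 < ν → ∀ x y z : ℝ, 0 < x → 0 < y → 0 < z →
          W (ν * x) (ν * y) (ν * z) = ν * W x y z) ∧
        (∀ x y z x' y' z' : ℝ, 0 < x → 0 < y → 0 < z → 0 < x' → 0 < y' → 0 < z' →
          W (x + x') (y + y') (z + z') ≤ W x y z + W x' y' z') ∧
        (∀ x y y' z : ℝ, 0 < x → 0 < y → y ≤ y' → 0 < z → W x y z ≤ W x y' z) ∧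
        (∀ x y z : ℝ, 0 < x → 0 < y → 0 < z →
          max (x + z) (max (x + y) (y + z)) ≤ W x y z ∧ W x y z ≤ x + y + z)) ∧
      (∃ K : ℕ, 2 ≤ K ∧ W 1 K 1 = K + 1) ∧
      (∀ m : ℝ, 1 < m → W 1 m 1 - (m + 1) ≤
        (1 - θ) * (((W 1 1 1 - 2) + (W 1 (2 * m - 1) 1 - 2 * m)) / 2) +
          θ * Real.sqrt ((W 1 1 1 - 2) * (W 1 (2 * m - 1) 1 - 2 * m))) ∧
      (¬ ∀ m : ℝ, 1 < m → (W 1 m 1 - (m + 1)) ^ 2 ≤ (W 1 1 1 - 2) * (W 1 (2 * m - 1) 1 - 2 * m)) ∧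
      2 < W 1 1 1 := by
  obtain ⟨j, hj⟩ := exists_pow_lt_of_lt_one (sub_pos.2 hθ) (by norm_num : (1 / 2 : ℝ) < 1)
  obtain ⟨W, hlaw, hfs, hgap, hnot, hone⟩ := gapWorld j (c := 1 / 2) (by norm_num) le_rfl
  have hθj : θ ≤ 1 - 1 / (2 * (2 : ℝ) ^ j) := by
    have h1 : 1 / (2 * (2 : ℝ) ^ j) ≤ (1 / 2 : ℝ) ^ j := by
      rw [one_div_pow, div_le_div_iff₀ (by positivity) (by positivity), one_mul, one_mul]
      linarith [show (0 : ℝ) < 2 ^ j by positivity]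
    linarith
  refine ⟨W, hlaw, hfs, fun m hm => ?_, hnot, by rw [hone]; norm_num⟩
  have h := hgap m hm
  have hsand := hlaw.2.2.2.2
  have hx : 0 ≤ W 1 1 1 - 2 := by rw [hone]; norm_num
  have hy : 0 ≤ W 1 (2 * m - 1) 1 - 2 * m := by
    have h' := (hsand 1 (2 * m - 1) 1 one_pos (by linarith) one_pos).1
    have : 1 + (2 * m - 1) ≤ max (1 + 1) (max (1 + (2 * m - 1)) ((2 * m - 1) + 1)) :=
      le_trans (le_max_left _ _) (le_max_right _ _)
    linarith
  have hag : Real.sqrt ((W 1 1 1 - 2) * (W 1 (2 * m - 1) 1 - 2 * m)) ≤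
      ((W 1 1 1 - 2) + (W 1 (2 * m - 1) 1 - 2 * m)) / 2 := by
    rw [Real.sqrt_mul' _ hy]
    nlinarith [Real.sq_sqrt hx, Real.sq_sqrt hy, Real.sqrt_nonneg (W 1 1 1 - 2),
      sq_nonneg (Real.sqrt (W 1 1 1 - 2) - Real.sqrt (W 1 (2 * m - 1) 1 - 2 * m))]
  nlinarith [mul_le_mul_of_nonneg_left hag (sub_nonneg.2 hθj)]

end Summit.MatrixMultiplication.MatrixMultiplication.Theorems.FarEdgeDescentGapFraction

end
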